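import Summits.QuantumFields.GaugeBoot.Rows.GLYZc2D4STab
import HarnessLib

/-!
# Gauge-boot: kernel check of the raw `site1` class table of the glyz-c2-4D problems, rows 40–62 (part 3/10)

Cell `pub-gaugeboot` (HOME `run/shared/lean/pub/pub-gaugeboot/`), seat lean1 (torus layer for rows C76–C87 = the certified
glyz-c2-4D windows: label set, raw blocks, class/witness tables, the reduction identity, per-β bindings).

HONEST FRAMING (page 1 of every file of this cell): certified bounds on lattice expectations at STATED coupling,
gauge group, dimension and torus size; NOT a mass gap, NOT a continuum limit, NOT a string tension, NOT large `N`.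
The venture is explicitly NOT Yang–Mills-summit-bearing (barriers `FixedCouplingUltralocality`,
`PerturbativeInvisibility`).

`scanon_rows_<lo>_<hi> : ∀ i, lo ≤ i < hi → ∀ j ≥ i, GLYZc2D4.SCanonOK i j`, each range one closed computation (`decide +kernel`);
assembled in `GLYZc2D4Canon`.
-/

noncomputable section

open Literature.MathematicalPhysics.QuantumFieldTheory

namespace Summit.QuantumFields.GaugeBoot

namespace GLYZc2D4

set_option maxHeartbeats 0 in
/-- Rows `40 ≤ i < 44` of the `site1` class table of the glyz-c2-4D problems canonicalise (1178 entries; kernel). -/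
theorem scanon_rows_40_44 : ∀ i : Fin 336, 40 ≤ i.val → i.val < 44 → ∀ j : Fin 336, i.val ≤ j.val → GLYZc2D4.SCanonOK i j := by
  decide +kernel

set_option maxHeartbeats 0 in
/-- Rows `44 ≤ i < 48` of the `site1` class table of the glyz-c2-4D problems canonicalise (1162 entries; kernel). -/
theorem scanon_rows_44_48 : ∀ i : Fin 336, 44 ≤ i.val → i.val < 48 → ∀ j : Fin 336, i.val ≤ j.val → GLYZc2D4.SCanonOK i j := by
  decide +kernel

set_option maxHeartbeats 0 in
/-- Rows `48 ≤ i < 53` of the `site1` class table of the glyz-c2-4D problems canonicalise (1430 entries; kernel). -/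
theorem scanon_rows_48_53 : ∀ i : Fin 336, 48 ≤ i.val → i.val < 53 → ∀ j : Fin 336, i.val ≤ j.val → GLYZc2D4.SCanonOK i j := by
  decide +kernel

set_option maxHeartbeats 0 in
/-- Rows `53 ≤ i < 58` of the `site1` class table of the glyz-c2-4D problems canonicalise (1405 entries; kernel). -/
theorem scanon_rows_53_58 : ∀ i : Fin 336, 53 ≤ i.val → i.val < 58 → ∀ j : Fin 336, i.val ≤ j.val → GLYZc2D4.SCanonOK i j := by
  decide +kernel

set_option maxHeartbeats 0 in
/-- Rows `58 ≤ i < 63` of the `site1` class table of the glyz-c2-4D problems canonicalise (1380 entries; kernel). -/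
theorem scanon_rows_58_63 : ∀ i : Fin 336, 58 ≤ i.val → i.val < 63 → ∀ j : Fin 336, i.val ≤ j.val → GLYZc2D4.SCanonOK i j := by
  decide +kernel

end GLYZc2D4

end Summit.QuantumFields.GaugeBoot

end
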